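import Summits.AtomisticToContinuum.FouriersLaw.Theses.OddSectorIrreversibility
import Literature.MathematicalPhysics.KineticTheory.OddSectorLocalityHypothesis

/-!
# `OddCorrectorDecay` / Negative: the locality obstruction — `¬ OddCorrectorDecay` modulo the `L²(Gibbs)` dictionary and fixed-time memory

Negative knowledge for crux `stmt-AtomisticToContinuum-9139`
(`OddSectorIrreversibility.OddCorrectorDecay`, rank 2 — the route's ENGINE), crux disprover,
2026-08-16.

## The obstruction (unitarity of the deterministic bulk + locality of the boundary noise)

Write `μ_T = e^{-H_N/T} dq dp` (the crux's unnormalised Gibbs weight), `J = J_tot = ∑_i j_i`,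
`P_t` the equilibrium transition semigroup (`OscillatorChain.transitionKernel N T T t`),
`Θ(q,p) = (q,-p)`, and
* `M_N := ‖J‖²_{L²(μ_T)}`                       (`currentNormSq`;   `≍ N`),
* `A_N(t) := ‖P_t J‖²_{L²(μ_T)}`                  (`forecastNormSq`;  the "memory" of the current),
* `B_N(u) := ⟨J, P_u J⟩_{L²(μ_T)}`                (`currentAutocorr`; the Green–Kubo integrand),
* `F_N(t)² := ‖P_t J - (P_t J)∘Θ‖²_{L²(μ_T)}`     (`oddPartNormSq`;   the crux integrand, squared).

The crux asks `∫₀^∞ F_N ≤ C √M_N` uniformly in `N`. Four standard facts about the equilibrium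
Langevin chain (the DICTIONARY; all unformalised — the tree has the
kernels, Chapman–Kolmogorov, Feller and Dynkin, but neither the invariance of `μ_T` under `P_t`
nor detailed balance):
1. `μ_T` is `P_t`-invariant, so `P_t` contracts `L²(μ_T)` and `t ↦ A_N(t)` is non-increasing
   [cite: BonettoLebowitzReyBellet2000, §4.1; CuneoEckmannHairerReyBellet2018, §3.1];
2. Cauchy–Schwarz: `B_N(u) ≤ M_N`;
3. GENERALISED DETAILED BALANCE `P_t* = Θ P_t Θ` on `L²(μ_T)` (`L† = ΘLΘ`, Kundu–Dhar–Narayan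
   eq. (reln2), the identity the route itself uses in `OddDensityIsCorrector`) gives, with the
   `Θ`-invariance of `μ_T` and `J∘Θ = -J`, the exact identity **`F_N(t)² = 2A_N(t) + 2B_N(2t)`**
   [cite: KunduDharNarayan2009, eq. (reln2)]: decay of the ODD part of `P_tJ` in norm is decay of
   the FULL norm `‖P_tJ‖`, up to the Green–Kubo integrand;
4. `u ↦ B_N(|u|)` is positive-definite (autocovariance of the stationary Markov process), in
   Fejér form `∫₀^S (S-u) B_N(u) du = ½ E(∫₀^S J(X_s)ds)² ≥ 0` [folklore].
From 1–4 and the crux's bound, `horizon_le_of_integrated_odd_decay` (PROVED, pure real analysis: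
`F ≥ F²/(2√M)`, Fejér weight `1 - t/S`, monotonicity of `A`) yields
  `A_N(S) ≤ 2C·M_N/S` for every `S > 0` and every `N`:
the boundary noise would have to destroy HALF of the `L²(μ_T)`-norm of the total current by the
FIXED time `4C`, uniformly in `N`. But the noise acts on the two end momenta only and the bulk
evolution is deterministic, i.e. UNITARY on `L²(μ_T)`: exactly,
`M_N - A_N(t) = E_μ Var(J(X_t) | X_0) = 2γT ∫₀ᵗ ∑_{b∈{0,N-1}} ‖∂_{p_b} P_sJ‖² ds`, and the
sensitivity of the forecast `P_sJ = ∑_z P_s j_z` to a boundary momentum is carried by the bonds the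
perturbation has reached by time `s` (finite propagation speed of perturbations in anharmonic
lattices [cite: MarchioroEtAl1978]; [cite: ButtaEtAl2007]),
so `M_N - A_N(t) = O_t(1)·N^{o(1)}` while `M_N ≍ N`: **`A_N(t)/M_N → 1` at every fixed `t`**
(the MEMORY hypothesis, stated in the weak form actually used: for every horizon `S` some `N`
keeps half of `M_N`). Physically `A_N(t) ≈ σ²(N - 2v_B t)₊` (butterfly front), `∫₀^∞ F_N ≍ N^{3/2}`,
`∫F_N/√M_N ≍ N` — the same order as for the harmonic chain, where the route file itself records
linear growth: anharmonicity is irrelevant to this obstruction, and Fourier's law is untouched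
(the resolvent form `‖P_odd u_N‖² = O(N)`, rank 3, integrates `P_tJ` BEFORE taking the norm).

## Contents
* `horizon_le_of_integrated_odd_decay` — the real-analysis core (PROVED).
* `oddCorrectorDecay_iff` — the crux through the Literature objects
  `OddSectorLocality.{oddPartNormSq, currentNormSq, …}` of
  `Literature/MathematicalPhysics/KineticTheory/OddSectorLocalityHypothesis.lean` (`Iff.rfl`).
* `oddCorrectorDecay_false_of_dictionary_of_memory` — dictionary (1)–(4) and memory as explicit
  hypotheses `⟹ ¬ OddCorrectorDecay` (PROVED).
* `oddCorrectorDecay_false_of_oddSectorLocalityHypothesis : H → ¬ OddCorrectorDecay` with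
  `H = Literature.MathematicalPhysics.KineticTheory.OddSectorLocalityHypothesis` (PROVED).
Nothing here closes an item: `H` is standard but not constructible in the tree today.
Since rev 16 of the route file (2026-08-16) the refuted decl `OddSectorIrreversibility.OddCorrectorDecay`
is no longer declared there; it is re-declared below (signature verbatim) so that this lane keeps
elaborating.
-/

/-! ### The refuted support decl, re-declared (route file rev 16 dropped it) -/

namespace Summit.AtomisticToContinuum.FouriersLaw.Theses.OddSectorIrreversibility

/-- The former support item `OddCorrectorDecay` of route OddSectorIrreversibility
(stmt-AtomisticToContinuum-9139, the rev 1–3 ENGINE; REFUTED by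
`Summit.AtomisticToContinuum.FouriersLaw.Theorems.not_OddCorrectorDecay`, 2026-08-16): for all
admissible `ω₂ lam β γ T` there is `C` with, for every `N`,
`t ↦ ‖P_tJ_tot − (P_tJ_tot)∘Θ‖_{L²(e^{-H_N/T})}` integrable on `(0,∞)` and
`∫₀^∞ ‖P_tJ_tot − (P_tJ_tot)∘Θ‖ dt ≤ C‖J_tot‖_{L²(e^{-H_N/T})}`. The route file stopped declaring it
at rev 16 (2026-08-16T09:03:08Z, dropped after its refutation landed; the refuted record is kept
there as a comment), so it is re-declared here, in the route's namespace and with the item's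
signature verbatim, solely so that this negative lane and the files downstream of it
(`…OddCorrectorDecayBathReduction`, `…OddCorrectorDecayRefutation` with `not_OddCorrectorDecay`)
keep elaborating unchanged (a definition, not a cited fact; the identical statement is also
`StaticIrreversibility.OddCorrectorDecay`, stmt-AtomisticToContinuum-6445, of the retired route
StaticIrreversibility). -/
def OddCorrectorDecay : Prop :=
  ∀ ω₂ lam β γ : ℝ, 0 < ω₂ → 0 < lam → 0 < β → 0 < γ → ∀ T : ℝ, 0 < T → ∃ C : ℝ, ∀ N : ℕ,
    MeasureTheory.IntegrableOn (fun t : ℝ => Real.sqrt (∫ x, ((∫ y, (∑ i : Fin N, (Literature.MathematicalPhysics.KineticTheory.HeatConduction.pinnedChain ω₂ lam β γ).bondCurrent N i y)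
        ∂((Literature.MathematicalPhysics.KineticTheory.HeatConduction.pinnedChain ω₂ lam β γ).transitionKernel N T T t.toNNReal x)) - (∫ y, (∑ i : Fin N, (Literature.MathematicalPhysics.KineticTheory.HeatConduction.pinnedChain ω₂ lam β γ).bondCurrent N i y)
        ∂((Literature.MathematicalPhysics.KineticTheory.HeatConduction.pinnedChain ω₂ lam β γ).transitionKernel N T T t.toNNReal (x.1, -x.2)))) ^ 2
        ∂(MeasureTheory.volume.withDensity (fun x : Literature.MathematicalPhysics.KineticTheory.HeatConduction.PhaseSpace N => ENNReal.ofReal (Real.exp (-((Literature.MathematicalPhysics.KineticTheory.HeatConduction.pinnedChain ω₂ lam β γ).hamiltonian N x) / T)))))) (Set.Ioi 0) ∧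
    ∫ t in Set.Ioi (0 : ℝ),
      Real.sqrt (∫ x, ((∫ y, (∑ i : Fin N, (Literature.MathematicalPhysics.KineticTheory.HeatConduction.pinnedChain ω₂ lam β γ).bondCurrent N i y)
        ∂((Literature.MathematicalPhysics.KineticTheory.HeatConduction.pinnedChain ω₂ lam β γ).transitionKernel N T T t.toNNReal x)) - (∫ y, (∑ i : Fin N, (Literature.MathematicalPhysics.KineticTheory.HeatConduction.pinnedChain ω₂ lam β γ).bondCurrent N i y)
        ∂((Literature.MathematicalPhysics.KineticTheory.HeatConduction.pinnedChain ω₂ lam β γ).transitionKernel N T T t.toNNReal (x.1, -x.2)))) ^ 2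
        ∂(MeasureTheory.volume.withDensity (fun x : Literature.MathematicalPhysics.KineticTheory.HeatConduction.PhaseSpace N => ENNReal.ofReal (Real.exp (-((Literature.MathematicalPhysics.KineticTheory.HeatConduction.pinnedChain ω₂ lam β γ).hamiltonian N x) / T))))) ≤
      C * Real.sqrt (∫ x, (∑ i : Fin N, (Literature.MathematicalPhysics.KineticTheory.HeatConduction.pinnedChain ω₂ lam β γ).bondCurrent N i x) ^ 2
        ∂(MeasureTheory.volume.withDensity (fun x : Literature.MathematicalPhysics.KineticTheory.HeatConduction.PhaseSpace N => ENNReal.ofReal (Real.exp (-((Literature.MathematicalPhysics.KineticTheory.HeatConduction.pinnedChain ω₂ lam β γ).hamiltonian N x) / T)))))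

end Summit.AtomisticToContinuum.FouriersLaw.Theses.OddSectorIrreversibility

noncomputable section

open MeasureTheory Set Filter Topology intervalIntegral
open Literature.MathematicalPhysics.KineticTheory.HeatConduction
open Summit.AtomisticToContinuum.FouriersLaw.Theses.OddSectorIrreversibility (OddCorrectorDecay)
open Literature.MathematicalPhysics.KineticTheory.OddSectorLocality

namespace Summit.AtomisticToContinuum.FouriersLaw.Theorems.OddSectorLocality

/-! ### The real-analysis core -/

/-- **Core inequality of the locality obstruction.** Let `F ≥ 0` be integrable on `(0,∞)` with
`∫_{(0,∞)} F ≤ C√M` (`M > 0`), and suppose `F(t)² = 2A(t) + 2B(2t)` for `t > 0` with `A`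
non-increasing on `[0,∞)`, `A ≤ M`, `B ≤ M` on `[0,∞)`, and `B` positive-definite in Fejér form at
horizon `2S`: `0 ≤ ∫₀^{2S} (2S-u)B(u)du`. If half of `M` survives in `A` at time `S`
(`M ≤ 2A(S)`), then `S ≤ 4C`. Proof: `F ≤ 2√M`, so
`∫F ≥ ∫₀^S (1-t/S)F ≥ ∫₀^S (1-t/S)F²/(2√M) = (∫₀^S(1-t/S)A + ∫₀^S(1-t/S)B(2·))/√M ≥ (S/2)A(S)/√M`.
[folklore] -/
theorem horizon_le_of_integrated_odd_decay {F A B : ℝ → ℝ} {M C S : ℝ} (hS : 0 < S) (hM : 0 < M)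
    (hFint : IntegrableOn F (Ioi 0))
    (hF0 : ∀ t, 0 ≤ F t)
    (hFsq : ∀ t, 0 < t → F t ^ 2 = 2 * A t + 2 * B (2 * t))
    (hAanti : AntitoneOn A (Ici 0)) (hAle : ∀ t, 0 ≤ t → A t ≤ M)
    (hBle : ∀ u, 0 ≤ u → B u ≤ M)
    (hFejer : 0 ≤ ∫ u in (0:ℝ)..(2 * S), (2 * S - u) * B u)
    (hle : ∫ t in Ioi 0, F t ≤ C * Real.sqrt M)
    (hmem : M ≤ 2 * A S) :
    S ≤ 4 * C := by
  have hsq : 0 < Real.sqrt M := Real.sqrt_pos.2 hM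
  have hsqsq : Real.sqrt M * Real.sqrt M = M := Real.mul_self_sqrt hM.le
  -- (1) `F ≤ 2√M` on `(0,∞)`
  have hFle : ∀ t, 0 < t → F t ≤ 2 * Real.sqrt M := by
    intro t ht
    have hA := hAle t ht.le
    have hB := hBle (2 * t) (by positivity)
    have h1 : F t ^ 2 ≤ 4 * M := by rw [hFsq t ht]; linarith
    nlinarith [hF0 t, hsq, hsqsq]
  -- the Fejér weight `1 - t/S` on `(0, S]`
  have hw0 : ∀ t ∈ Ioc (0:ℝ) S, 0 ≤ 1 - t / S := fun t ht => by
    have : t / S ≤ 1 := (div_le_one hS).2 ht.2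
    linarith
  have hw1 : ∀ t ∈ Ioc (0:ℝ) S, 1 - t / S ≤ 1 := fun t ht => by
    have : 0 ≤ t / S := div_nonneg ht.1.le hS.le
    linarith
  have hwc : Continuous fun t : ℝ => 1 - t / S := by fun_prop
  have hwm : AEStronglyMeasurable (fun t : ℝ => 1 - t / S) (volume.restrict (Ioc 0 S)) :=
    hwc.aestronglyMeasurable
  have hwbd : ∀ᵐ t ∂(volume.restrict (Ioc (0:ℝ) S)), ‖(1 : ℝ) - t / S‖ ≤ 1 := by
    refine (ae_restrict_mem measurableSet_Ioc).mono fun t ht => ?_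
    rw [Real.norm_eq_abs, abs_le]
    constructor <;> linarith [hw0 t ht, hw1 t ht]
  -- pointwise comparison `(1 - t/S) F²/(2√M) ≤ (1 - t/S) F` on `(0, S]`
  have hpt : ∀ t ∈ Ioc (0:ℝ) S,
      (1 - t / S) * F t ^ 2 / (2 * Real.sqrt M) ≤ (1 - t / S) * F t := by
    intro t ht
    have hF := hFle t ht.1
    have h1 : F t ^ 2 / (2 * Real.sqrt M) ≤ F t := by
      rw [div_le_iff₀ (by positivity)]
      nlinarith [hF0 t]
    calc (1 - t / S) * F t ^ 2 / (2 * Real.sqrt M)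
        = (1 - t / S) * (F t ^ 2 / (2 * Real.sqrt M)) := by ring
      _ ≤ (1 - t / S) * F t := mul_le_mul_of_nonneg_left h1 (hw0 t ht)
  -- integrability bookkeeping
  have hI1 : IntegrableOn F (Ioc 0 S) := hFint.mono_set Ioc_subset_Ioi_self
  have hI2 : IntegrableOn (fun t => (1 - t / S) * F t) (Ioc 0 S) := hI1.bdd_mul hwm hwbd
  have hI3 : IntegrableOn (fun t => (1 - t / S) * F t ^ 2 / (2 * Real.sqrt M)) (Ioc 0 S) := by
    refine Integrable.mono' hI2 ?_ ?_
    · have hFam : AEMeasurable F (volume.restrict (Ioc 0 S)) := hI1.aestronglyMeasurable.aemeasurable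
      have hm : AEMeasurable (fun t => (1 - t / S) * F t ^ 2 / (2 * Real.sqrt M))
          (volume.restrict (Ioc 0 S)) := by fun_prop
      exact hm.aestronglyMeasurable
    · refine (ae_restrict_mem measurableSet_Ioc).mono fun t ht => ?_
      rw [Real.norm_eq_abs, abs_of_nonneg (by have := hw0 t ht; have := hF0 t; positivity)]
      exact hpt t ht
  have hAint : IntegrableOn A (Icc 0 S) :=
    (hAanti.mono Icc_subset_Ici_self).integrableOn_isCompact isCompact_Icc
  have hI4 : IntegrableOn (fun t => (1 - t / S) * A t) (Ioc 0 S) :=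
    (IntegrableOn.continuousOn_mul hwc.continuousOn hAint isCompact_Icc).mono_set Ioc_subset_Icc_self
  have hI5 : IntegrableOn (fun t => (1 - t / S) * B (2 * t)) (Ioc 0 S) := by
    have h : EqOn (fun t => (1 - t / S) * F t ^ 2 / (2 * Real.sqrt M) * Real.sqrt M - (1 - t / S) * A t)
        (fun t => (1 - t / S) * B (2 * t)) (Ioc 0 S) := by
      intro t ht
      beta_reduce
      rw [hFsq t ht.1]
      field_simp
      ring
    have h' : IntegrableOn
        (fun t => (1 - t / S) * F t ^ 2 / (2 * Real.sqrt M) * Real.sqrt M - (1 - t / S) * A t)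
        (Ioc 0 S) := (hI3.mul_const _).sub hI4
    exact h'.congr_fun h measurableSet_Ioc
  -- (2) `∫_{(0,S]} (1 - t/S) F ≤ ∫_{(0,∞)} F`
  have h2 : ∫ t in Ioc 0 S, (1 - t / S) * F t ≤ ∫ t in Ioi 0, F t := by
    calc ∫ t in Ioc 0 S, (1 - t / S) * F t ≤ ∫ t in Ioc 0 S, F t :=
          setIntegral_mono_on hI2 hI1 measurableSet_Ioc fun t ht => by
            have := hw1 t ht
            have := hF0 t
            nlinarith
      _ ≤ ∫ t in Ioi 0, F t :=
          setIntegral_mono_set hFint (Filter.Eventually.of_forall fun t => hF0 t)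
            Ioc_subset_Ioi_self.eventuallyLE
  -- (3) `∫ (1 - t/S) F²/(2√M) ≤ ∫ (1 - t/S) F`
  have h3 : ∫ t in Ioc 0 S, (1 - t / S) * F t ^ 2 / (2 * Real.sqrt M)
      ≤ ∫ t in Ioc 0 S, (1 - t / S) * F t :=
    setIntegral_mono_on hI3 hI2 measurableSet_Ioc hpt
  -- (4) split `F² = 2A + 2B(2·)`
  have h4 : ∫ t in Ioc 0 S, (1 - t / S) * F t ^ 2 / (2 * Real.sqrt M)
      = ((∫ t in Ioc 0 S, (1 - t / S) * A t) + ∫ t in Ioc 0 S, (1 - t / S) * B (2 * t)) /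
          Real.sqrt M := by
    rw [← integral_add hI4 hI5, ← MeasureTheory.integral_div]
    refine setIntegral_congr_fun measurableSet_Ioc fun t ht => ?_
    rw [hFsq t ht.1]
    field_simp
  -- (5) the `A` part: `A S · S/2 ≤ ∫ (1 - t/S) A`
  have hlin : ∫ t in (0:ℝ)..S, (1 - t / S) = S / 2 := by
    rw [intervalIntegral.integral_sub intervalIntegrable_const
        ((by fun_prop : Continuous fun t : ℝ => t / S).intervalIntegrable _ _),
      intervalIntegral.integral_const, intervalIntegral.integral_div, integral_id]
    field_simp
    ring
  have h5 : A S * (S / 2) ≤ ∫ t in Ioc 0 S, (1 - t / S) * A t := by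
    have hc : ∫ t in Ioc 0 S, (1 - t / S) * A S = A S * (S / 2) := by
      rw [← intervalIntegral.integral_of_le hS.le, intervalIntegral.integral_mul_const, hlin]
      ring
    rw [← hc]
    refine setIntegral_mono_on ?_ hI4 measurableSet_Ioc fun t ht => ?_
    · exact ((hwc.mul continuous_const).integrableOn_Icc).mono_set Ioc_subset_Icc_self
    · exact mul_le_mul_of_nonneg_left
        (hAanti (show t ∈ Ici (0:ℝ) from ht.1.le) (show S ∈ Ici (0:ℝ) from hS.le) ht.2) (hw0 t ht)
  -- (6) the `B` part is `≥ 0` (Fejér positivity after `u = 2t`)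
  have h6 : 0 ≤ ∫ t in Ioc 0 S, (1 - t / S) * B (2 * t) := by
    rw [← intervalIntegral.integral_of_le hS.le]
    have h2S := intervalIntegral.integral_comp_mul_left (a := (0:ℝ)) (b := S)
      (fun u => (2 * S)⁻¹ * ((2 * S - u) * B u)) (two_ne_zero)
    simp only [mul_zero, smul_eq_mul] at h2S
    have key : ∫ t in (0:ℝ)..S, (1 - t / S) * B (2 * t)
        = ∫ t in (0:ℝ)..S, (2 * S)⁻¹ * ((2 * S - 2 * t) * B (2 * t)) :=
      intervalIntegral.integral_congr fun t _ => by
        field_simp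
    rw [key, h2S, intervalIntegral.integral_const_mul]
    exact mul_nonneg (by norm_num) (mul_nonneg (by positivity) hFejer)
  -- (7) assemble
  have h7 : A S * (S / 2) / Real.sqrt M ≤ C * Real.sqrt M := by
    calc A S * (S / 2) / Real.sqrt M
        ≤ ((∫ t in Ioc 0 S, (1 - t / S) * A t) + ∫ t in Ioc 0 S, (1 - t / S) * B (2 * t)) /
            Real.sqrt M := by
          gcongr
          linarith
      _ = ∫ t in Ioc 0 S, (1 - t / S) * F t ^ 2 / (2 * Real.sqrt M) := h4.symm
      _ ≤ ∫ t in Ioc 0 S, (1 - t / S) * F t := h3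
      _ ≤ ∫ t in Ioi 0, F t := h2
      _ ≤ C * Real.sqrt M := hle
  have h8 : M / 2 * (S / 2) / Real.sqrt M ≤ C * Real.sqrt M := by
    refine le_trans ?_ h7
    gcongr
    linarith
  have h9 : M / 2 * (S / 2) / Real.sqrt M = S / 4 * Real.sqrt M := by
    rw [div_eq_iff hsq.ne']
    nlinarith [hsqsq]
  rw [h9] at h8
  have := le_of_mul_le_mul_right h8 hsq
  linarith

/-! ### The crux through the Literature objects -/

/-- The crux, restated through `OddSectorLocality.oddPartNormSq` / `currentNormSq` (definitional).
[folklore] -/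
theorem oddCorrectorDecay_iff :
    OddCorrectorDecay ↔
      ∀ ω₂ lam β γ : ℝ, 0 < ω₂ → 0 < lam → 0 < β → 0 < γ → ∀ T : ℝ, 0 < T → ∃ C : ℝ, ∀ N : ℕ,
        IntegrableOn (fun t : ℝ => Real.sqrt (oddPartNormSq ω₂ lam β γ T N t)) (Ioi 0) ∧
          ∫ t in Ioi (0:ℝ), Real.sqrt (oddPartNormSq ω₂ lam β γ T N t) ≤
            C * Real.sqrt (currentNormSq ω₂ lam β γ T N) :=
  Iff.rfl

/-! ### The negative lemma, with the dictionary and the memory as explicit hypotheses -/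

/-- **`OddCorrectorDecay` is false given, at ONE admissible parameter point, the `L²(μ_T)`
dictionary of the equilibrium open chain and fixed-time memory.** The four dictionary hypotheses,
for the length `N` supplied by the memory hypothesis: (1) `t ↦ A_N(t) = ‖P_tJ‖²` is non-increasing
on `[0,∞)` (invariance of the Gibbs weight under `P_t` + Jensen)
[cite: BonettoLebowitzReyBellet2000, §4.1]; (2) `B_N(u) ≤ M_N` (Cauchy–Schwarz + contraction);
(3) the odd-norm identity `F_N(t)² = 2A_N(t) + 2B_N(2t)` (`Θ`-invariance of `μ_T`, `J∘Θ = -J`,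
generalised detailed balance `P_t* = ΘP_tΘ` [cite: KunduDharNarayan2009, eq. (reln2)]);
(4) Fejér positivity of the stationary autocovariance, `0 ≤ ∫₀^S (S-u)B_N(u)du`. Memory:
`0 < M_N ≤ 2A_N(S)` at the horizon `S = 4 max(C,0) + 4` built from the crux's constant — so the
statement is applied through `oddCorrectorDecay_false_of_oddSectorLocalityHypothesis` below, where
the memory hypothesis provides `N` for every horizon. Proof: the core inequality gives `S ≤ 4C < S`.
[folklore] -/
theorem oddCorrectorDecay_false_of_dictionary_of_memory {ω₂ lam β γ T : ℝ} (hω : 0 < ω₂)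
    (hl : 0 < lam) (hβ : 0 < β) (hγ : 0 < γ) (hT : 0 < T)
    (hD : ∀ N : ℕ,
      AntitoneOn (forecastNormSq ω₂ lam β γ T N) (Ici 0) ∧
      (∀ u : ℝ, 0 ≤ u → currentAutocorr ω₂ lam β γ T N u ≤ currentNormSq ω₂ lam β γ T N) ∧
      (∀ t : ℝ, 0 ≤ t → oddPartNormSq ω₂ lam β γ T N t =
        2 * forecastNormSq ω₂ lam β γ T N t + 2 * currentAutocorr ω₂ lam β γ T N (2 * t)) ∧
      (∀ S : ℝ, 0 < S → 0 ≤ ∫ u in (0:ℝ)..S, (S - u) * currentAutocorr ω₂ lam β γ T N u))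
    (hMem : ∀ S : ℝ, 0 < S → ∃ N : ℕ, 0 < currentNormSq ω₂ lam β γ T N ∧
      currentNormSq ω₂ lam β γ T N ≤ 2 * forecastNormSq ω₂ lam β γ T N S) :
    ¬ OddCorrectorDecay := by
  intro hOSD
  obtain ⟨C, hC⟩ := (oddCorrectorDecay_iff.1 hOSD) ω₂ lam β γ hω hl hβ hγ T hT
  set S : ℝ := 4 * max C 0 + 4 with hSdef
  have hmax : 0 ≤ max C 0 := le_max_right _ _
  have hS : 0 < S := by rw [hSdef]; linarith
  obtain ⟨N, hMpos, hmem⟩ := hMem S hS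
  obtain ⟨hint, hle⟩ := hC N
  obtain ⟨hanti, hB, hid, hfejer⟩ := hD N
  have hAle : ∀ t : ℝ, 0 ≤ t → forecastNormSq ω₂ lam β γ T N t ≤ currentNormSq ω₂ lam β γ T N := by
    intro t ht
    rw [← forecastNormSq_zero hω hl.le hβ.le hγ.le T N]
    exact hanti (mem_Ici.2 le_rfl) (mem_Ici.2 ht) ht
  have hodd0 : ∀ t : ℝ, 0 ≤ oddPartNormSq ω₂ lam β γ T N t :=
    fun t => integral_nonneg fun x => sq_nonneg _
  have key := horizon_le_of_integrated_odd_decay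
    (F := fun t => Real.sqrt (oddPartNormSq ω₂ lam β γ T N t))
    (A := forecastNormSq ω₂ lam β γ T N) (B := currentAutocorr ω₂ lam β γ T N)
    hS hMpos hint (fun t => Real.sqrt_nonneg _)
    (fun t ht => by rw [Real.sq_sqrt (hodd0 t), hid t ht.le]) hanti hAle hB
    (hfejer (2 * S) (by positivity)) hle hmem
  have hC' : C ≤ max C 0 := le_max_left _ _
  linarith

/-! ### The negative lemma modulo `H` -/

/-- **Negative lemma (modulo `H`):
`Literature.MathematicalPhysics.KineticTheory.OddSectorLocalityHypothesis → ¬ OddCorrectorDecay`.**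
[folklore] -/
theorem oddCorrectorDecay_false_of_oddSectorLocalityHypothesis
    (h : Literature.MathematicalPhysics.KineticTheory.OddSectorLocalityHypothesis) :
    ¬ OddCorrectorDecay := by
  obtain ⟨ω₂, lam, β, γ, T, hω, hl, hβ, hγ, hT, hD, hMem⟩ := h
  exact oddCorrectorDecay_false_of_dictionary_of_memory hω hl hβ hγ hT hD hMem

end Summit.AtomisticToContinuum.FouriersLaw.Theorems.OddSectorLocality
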